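import Summits.MatrixMultiplication.MatrixMultiplication.Theses.WindowedCompletionRank
import Literature.Computability.AlgebraicComplexity.FlatteningBound
import Literature.Computability.AlgebraicComplexity.LaserSymmetrization

/-!
# `WindowedCompletionRank.Thesis` (crux stmt-MatrixMultiplication-5491): forced normalisations

Negative-side support file of the refuter's crux attack (2026-08-17); `sorry`-free.
The crux quantifies over ARBITRARY index maps `α β γ : [n]² → G` and asks only that `⟨n,n,n⟩` be a
RESTRICTION of the window tensor `W(a,b,c) = [α b + β c = γ a]·S(γ a, α b, β c)`. Conciseness of
`⟨n,n,n⟩` forces the normalisations the informal text takes for granted: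

* `card_le_card_image_of_restrictsTo` — if `s ≤ t` and the first index of `t` factors through a map
  `f : ι → X`, then the number of linearly independent first-index slices of `s` is at most
  `|image f|` (the slices of `s` lie in the span of `|image f|` matrices).
* `injective_of_windowPresentation` — in every windowed presentation of `⟨n,n,n⟩` (`n ≥ 1`) the
  maps `α`, `β`, `γ` are injective (flattenings of `⟨n,n,n⟩` have rank `n²` in all three legs);
* `sq_le_card_of_windowPresentation` — hence `n² ≤ |G|`: groups smaller than the format never
  occur, the admissible range in `Thesis` is `n² ≤ |G| ≤ n^(2+ε)`, and (same format, full
  flattening ranks) the restriction `⟨n,n,n⟩ ≤ W` is then an isomorphism of tensors — `Thesis` asks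
  for `⟨n,n,n⟩` itself, in suitable bases, to BE a windowed Hadamard product.
-/

-- single-problem summit: `Summit.MatrixMultiplication.MatrixMultiplication.…` is the mandated namespace
set_option linter.dupNamespace false

namespace Summit.MatrixMultiplication.MatrixMultiplication.Theorems.Thesis.Negative

open Module Literature.Computability.AlgebraicComplexity

/-- **Slices of a restriction through a factored index.** If `s` is a restriction of the tensor
`(a, b, c) ↦ t (f a) b c` whose first index factors through `f : ι → X`, then every first-index
slice of `s` lies in the span of the `|image f|` matrices `(B ⊗ C)·t(x, ·, ·)`, `x ∈ image f`; so
at most `|image f|` slices of `s` are linearly independent. -/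
theorem card_le_card_image_of_restrictsTo {K : Type*} [Field K] {ι κ μ ι' κ' μ' X : Type*}
    [Fintype ι] [Fintype κ] [Fintype μ] [Fintype ι'] [Fintype κ'] [Fintype μ'] [DecidableEq X]
    (f : ι → X) (t : X → κ → μ → K) (s : ι' → κ' → μ' → K)
    (h : TensorRestrictsTo (fun a b c => t (f a) b c) s)
    (hs : LinearIndependent K (fun a' => s a' : ι' → κ' → μ' → K)) :
    Fintype.card ι' ≤ (Finset.univ.image f).card := by
  obtain ⟨A, B, C, hs'⟩ := h
  -- the matrices `V x = (B ⊗ C)·t(x,·,·)`, indexed by the finset `image f`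
  let V : X → κ' → μ' → K := fun x b' c' => ∑ b, ∑ c, B b' b * C c' c * t x b c
  let T : Finset X := Finset.univ.image f
  let M : T → κ' → μ' → K := fun x => V x
  let W : Submodule K (κ' → μ' → K) := Submodule.span K (Set.range M)
  have hmem : ∀ a', s a' ∈ W := by
    intro a'
    have hsa : s a' = ∑ a, A a' a • V (f a) := by
      funext b' c'
      rw [hs' a' b' c']
      simp only [Finset.sum_apply, Pi.smul_apply, smul_eq_mul, V, Finset.mul_sum]
      refine Finset.sum_congr rfl fun a _ => Finset.sum_congr rfl fun b _ =>
        Finset.sum_congr rfl fun c _ => ?_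
      ring
    rw [hsa]
    refine W.sum_mem fun a _ => W.smul_mem _ (Submodule.subset_span ?_)
    exact ⟨⟨f a, Finset.mem_image_of_mem f (Finset.mem_univ a)⟩, rfl⟩
  have h' : LinearIndependent K (fun a' => (⟨s a', hmem a'⟩ : W)) :=
    LinearIndependent.of_comp W.subtype hs
  calc Fintype.card ι' ≤ finrank K W := h'.fintype_card_le_finrank
    _ ≤ Fintype.card T := finrank_range_le_card M
    _ = T.card := Fintype.card_coe T

/-- A map whose image has at least `|ι|` elements is injective. -/
theorem injective_of_card_le_card_image {ι X : Type*} [Fintype ι] [DecidableEq X] {f : ι → X}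
    (h : Fintype.card ι ≤ (Finset.univ.image f).card) : Function.Injective f := by
  have heq : (Finset.univ.image f).card = (Finset.univ : Finset ι).card :=
    le_antisymm Finset.card_image_le (by rwa [Finset.card_univ])
  have hinj := Finset.card_image_iff.mp heq
  rw [Finset.coe_univ] at hinj
  exact Set.injOn_univ.mp hinj

/-- **Injectivity is forced.** In every windowed presentation
`⟨n,n,n⟩ ≤ [α b + β c = γ a]·S(γ a, α b, β c)` (`n ≥ 1`, any finite abelian `G`, ANY maps
`α β γ : [n]² → G`) the three index maps are injective: the window tensor's `a`-slices factor
through `γ` (resp. `b`-slices through `α`, `c`-slices through `β`), while the `n²` slices of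
`⟨n,n,n⟩` in each leg are linearly independent (conciseness), and restriction cannot create
independent slices (`card_le_card_image_of_restrictsTo`, with `TensorRestrictsTo.rotate` for the
second and third legs). -/
theorem injective_of_windowPresentation {n : ℕ} (hn : 1 ≤ n) {G : Type} [AddCommGroup G]
    [Fintype G] [DecidableEq G] (α β γ : Fin n × Fin n → G) (S : G → G → G → ℂ)
    (hres : TensorRestrictsTo
      (fun a b c : Fin n × Fin n => if α b + β c = γ a then S (γ a) (α b) (β c) else 0)
      (matMulTensor ℂ n n n)) :
    Function.Injective α ∧ Function.Injective β ∧ Function.Injective γ := by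
  haveI : NeZero n := ⟨by omega⟩
  have hγ : Fintype.card (Fin n × Fin n) ≤ (Finset.univ.image γ).card :=
    card_le_card_image_of_restrictsTo γ
      (fun g (b c : Fin n × Fin n) => if α b + β c = g then S g (α b) (β c) else 0) _ hres
      (linearIndependent_matMulTensor ℂ n n n)
  have hα : Fintype.card (Fin n × Fin n) ≤ (Finset.univ.image α).card :=
    card_le_card_image_of_restrictsTo α
      (fun u (c a : Fin n × Fin n) => if u + β c = γ a then S (γ a) u (β c) else 0) _ hres.rotate
      (linearIndependent_rotate_matMulTensor ℂ n n n)
  have hβ : Fintype.card (Fin n × Fin n) ≤ (Finset.univ.image β).card :=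
    card_le_card_image_of_restrictsTo β
      (fun v (a b : Fin n × Fin n) => if α b + v = γ a then S (γ a) (α b) v else 0) _
      hres.rotate.rotate (linearIndependent_rotate_rotate_matMulTensor ℂ n n n)
  exact ⟨injective_of_card_le_card_image hα, injective_of_card_le_card_image hβ,
    injective_of_card_le_card_image hγ⟩

/-- **`n² ≤ |G|` is forced.** In every windowed presentation of `⟨n,n,n⟩` (`n ≥ 1`) the group has
at least `n²` elements (`γ` is injective on `[n]²`). With `Thesis`'s upper bound this pins the
admissible range to `n² ≤ |G| ≤ n^(2+ε)`; the trivial group, or any `G` smaller than the format,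
never presents `⟨n,n,n⟩`. -/
theorem sq_le_card_of_windowPresentation {n : ℕ} (hn : 1 ≤ n) {G : Type} [AddCommGroup G]
    [Fintype G] [DecidableEq G] (α β γ : Fin n × Fin n → G) (S : G → G → G → ℂ)
    (hres : TensorRestrictsTo
      (fun a b c : Fin n × Fin n => if α b + β c = γ a then S (γ a) (α b) (β c) else 0)
      (matMulTensor ℂ n n n)) :
    n ^ 2 ≤ Fintype.card G := by
  have hγ := (injective_of_windowPresentation hn α β γ S hres).2.2
  have h := Fintype.card_le_of_injective γ hγ
  simpa [sq] using h

end Summit.MatrixMultiplication.MatrixMultiplication.Theorems.Thesis.Negative
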